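/-
Origin: expansion seat `planner-pub-hodgecm-pv10-g5-0`, handover #6(1/6) 2026-08-18T15:21:38Z (supersedes #3 402ebbfc) (`HOME/pub-hodgecm-pv10-g5/lean/Pv10g5/QuotientHolomorphic.lean`, md5 87536c54, 263 lines);
landed by the gen-8 packager in gate run 31 as `HodgeCM/PerL34/QuotientHolomorphic.lean` (stripped 4 #print/#check/#eval lines).
-/
/-
Origin: pub-hodgecm speedrun cell, seat pv10-g5 (DAG-NODE PROVER #10, gen 5), 2026-08-18.  STAGING for the tree import
(LEAN-IN-TREE RULE 2026-08-18): tree-shaped (≤ 400 lines, docstring on every decl, general engine and ball/PerL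
specialisation in separate files); see `HOME/pub-hodgecm-pv10-g5/MODULE-MAP-pv10.md`.
Target path: `HodgeCM/PerL34/QuotientHolomorphic.lean`.  Proposed tree home: the manifold-quotient ENGINE module
(Mathlib-level, ball-free) next to `QuotientManifold`.
Import is a TREE module (`HodgeCM.PerL34.QuotientManifold` = this seat's RUN-30 file): NO import rewrite at landing.
KERNEL, nothing cited, nothing posited.
-/
import Summits.HodgeConjecture.HodgeCM.PerL34.QuotientManifold

/-!
# The quotient map `M → G\M` is a `C^n` local diffeomorphism; maps `G₁\M → G\M` over `M` are `C^n`

General engine (ns `HodgeCM.PerL34.QuotientManifold`, continuing `QuotientManifold.lean`): for a free properly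
discontinuous action of `G` on a charted space `M` by maps of `contDiffGroupoid n I` (`ActsBy`, the hypothesis
`hG` of `isManifold_orbitRelQuotient`), with the quotient `C^n` structure of that file:

* every quotient chart `σ_p ≫ c` (`σ_p` a local section of `π`, `c` ANY chart of `M`) lies in the maximal
  `C^n` atlas of `G\M` (`localSection_trans_mem_maximalAtlas`);
* the quotient map `π : M → G\M` is `C^n` and a `C^n` local diffeomorphism (`contMDiff_mk`,
  `isLocalDiffeomorph_mk`, `mkPartialDiffeomorph`) — the second item of the TODO in Mathlib's
  `Geometry/Manifold/Instances/Quotient.lean`; its local sections are `C^n` (`contMDiffOn_localSection`);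
* any map `f : G₁\M → G\M` of quotients by two such actions with `f ∘ π₁ = π` (e.g. induced by `G₁ ≤ G`) is
  `C^n` and a `C^n` local diffeomorphism (`contMDiff_of_comp_mk_eq`, `isLocalDiffeomorph_of_comp_mk_eq`).

The ball / PerL specialisation (`𝔹² → Γ\𝔹²` and `Γ₁\𝔹² → Γ\𝔹²` holomorphic local biholomorphisms,
`HermSpace3.exists_ballPieces_holomorphicCovering`) is the companion file `BallHolomorphic`.
`#print axioms` of every result = `[propext, Classical.choice, Quot.sound]`.
-/

noncomputable section

open scoped Matrix Pointwise Manifold ContDiff Topology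
open MulAction Set

namespace HodgeCM.PerL34.QuotientManifold

variable {G : Type*} [Group G] {M : Type*} [TopologicalSpace M] [MulAction G M]
  [ProperlyDiscontinuousSMul G M] [ContinuousConstSMul G M] [IsCancelSMul G M] [T2Space M]
  [LocallyCompactSpace M] {H : Type*} [TopologicalSpace H] [ChartedSpace H M]

/-! ### Local sections (complements to `QuotientManifold.lean`) -/

/-- (Ported verbatim from the HodgeCMPerL package; no docstring in the source.) -/
theorem mem_localSection_source (p : M) : Quotient.mk (orbitRel G M) p ∈ (localSection G p).source :=
  (isLocalHomeomorph_mk G M).apply_self_mem_localInverseAt_source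

/-- The base point `p` lies in the target of the local section `localSection G p`. -/
theorem mem_localSection_target (p : M) : p ∈ (localSection G p).target :=
  (isLocalHomeomorph_mk G M).self_mem_localInverseAt_target

/-- The local section at `p` sends the orbit of `p` back to `p`. -/
theorem localSection_apply_mk (p : M) : localSection G p (Quotient.mk (orbitRel G M) p) = p :=
  (isLocalHomeomorph_mk G M).localInverseAt_apply_self

/-- The inverse of the local section at `p` is (the restriction of) the quotient map. -/
theorem localSection_symm_eq (p : M) :
    ((localSection G p).symm : M → orbitRel.Quotient G M) = Quotient.mk (orbitRel G M) :=
  (isLocalHomeomorph_mk G M).localInverseAt_symm p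

/-- Two local sections of `π : M → G\M` that agree at a point agree near it. -/
theorem localSection_eventuallyEq (p p' : M) {q₀ : orbitRel.Quotient G M}
    (hq : q₀ ∈ (localSection G p).source) (hq' : q₀ ∈ (localSection G p').source)
    (h : localSection G p q₀ = localSection G p' q₀) :
    localSection G p =ᶠ[𝓝 q₀] localSection G p' := by
  have hinj := (isLocalHomeomorph_mk G M).injOn_localInverseAt_target (x := p)
  have h1 : ∀ᶠ q in 𝓝 q₀, q ∈ (localSection G p).source := (localSection G p).open_source.mem_nhds hq
  have h2 : ∀ᶠ q in 𝓝 q₀, q ∈ (localSection G p').source := (localSection G p').open_source.mem_nhds hq'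
  have h3 : ∀ᶠ q in 𝓝 q₀, localSection G p' q ∈ (localSection G p).target := by
    have hc : ContinuousAt (localSection G p') q₀ := (localSection G p').continuousAt hq'
    refine hc.preimage_mem_nhds ((localSection G p).open_target.mem_nhds ?_)
    rw [← h]
    exact (localSection G p).map_source hq
  filter_upwards [h1, h2, h3] with q m1 m2 m3
  refine hinj ((localSection G p).map_source m1) m3 ?_
  rw [mk_localSection_apply p m1, mk_localSection_apply p' m2]

/-! ### Acting by groupoid maps; the quotient charts `σ_p ≫ c` lie in the maximal atlas -/

variable (G M) in
/-- `G` acts on the charted space `M` by maps of the structure groupoid `Gr`: every `(g • ·)`, read in any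
two charts of `M`, belongs to `Gr` (the hypothesis `hG` of `QuotientManifold.hasGroupoid_orbitRelQuotient`). -/
def ActsBy (Gr : StructureGroupoid H) : Prop :=
  ∀ g : G, ∀ e ∈ atlas H M, ∀ e' ∈ atlas H M,
    e.symm.trans ((Homeomorph.smul g : M ≃ₜ M).toOpenPartialHomeomorph.trans e') ∈ Gr

/-- Compatibility of ANY two quotient charts `σ_p ≫ c`, `σ_{p'} ≫ c'` (`c, c'` charts of `M`, `p, p'`
arbitrary): the argument of `hasGroupoid_orbitRelQuotient`, for charts not necessarily in the chosen atlas. -/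
theorem symm_trans_mem_of_actsBy {Gr : StructureGroupoid H} [ClosedUnderRestriction Gr]
    (hG : ActsBy G M Gr) (p p' : M) {c c' : OpenPartialHomeomorph M H} (hc : c ∈ atlas H M)
    (hc' : c' ∈ atlas H M) :
    ((localSection G p).trans c).symm.trans ((localSection G p').trans c') ∈ Gr := by
  rw [OpenPartialHomeomorph.trans_symm_eq_symm_trans_symm, OpenPartialHomeomorph.trans_assoc,
    ← OpenPartialHomeomorph.trans_assoc (localSection G p).symm]
  change c.symm.trans ((deck G p p').trans c') ∈ Gr
  apply Gr.locality
  intro y hy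
  have hy' := hy
  simp only [OpenPartialHomeomorph.trans_source, OpenPartialHomeomorph.symm_source, mem_inter_iff,
    mem_preimage] at hy'
  obtain ⟨hyt, hx, -⟩ := hy'
  obtain ⟨g, hg⟩ := exists_deck_eventuallyEq_smul p p' hx
  obtain ⟨V, hV, hVo, hxV⟩ := eventually_nhds_iff.mp hg
  have hWo : IsOpen ((deck G p p').source ∩ V) := (deck G p p').open_source.inter hVo
  refine ⟨c.target ∩ c.symm ⁻¹' ((deck G p p').source ∩ V), c.isOpen_inter_preimage_symm hWo,
    ⟨hyt, hx, hxV⟩, ?_⟩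
  refine Gr.mem_of_eqOnSource (closedUnderRestriction' (hG g _ hc _ hc') (c.isOpen_inter_preimage_symm hWo)) ?_
  exact restr_conj_eqOnSource c c' (deck G p p') (Homeomorph.smul g : M ≃ₜ M).toOpenPartialHomeomorph hWo
    inter_subset_left (by simp only [Homeomorph.toOpenPartialHomeomorph_source, subset_univ])
    (fun z hz => hV z hz.2)

/-- Every `σ_p ≫ c` (`p : M`, `c` a chart of `M`) belongs to the MAXIMAL atlas of `G\M` for `Gr`. -/
theorem localSection_trans_mem_maximalAtlas {Gr : StructureGroupoid H} [ClosedUnderRestriction Gr]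
    (hG : ActsBy G M Gr) (p : M) {c : OpenPartialHomeomorph M H} (hc : c ∈ atlas H M) :
    (localSection G p).trans c ∈ Gr.maximalAtlas (orbitRel.Quotient G M) := by
  rw [_root_.mem_maximalAtlas_iff]
  intro e' he'
  obtain ⟨p', rfl⟩ := exists_eq_localSection_trans he'
  exact ⟨symm_trans_mem_of_actsBy hG p p' hc (chart_mem_atlas H p'),
    symm_trans_mem_of_actsBy hG p' p (chart_mem_atlas H p') hc⟩

/-! ### Smoothness -/

section Smooth

variable {𝕜 : Type*} [NontriviallyNormedField 𝕜] {E : Type*} [NormedAddCommGroup E] [NormedSpace 𝕜 E]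
  {I : ModelWithCorners 𝕜 E H} {n : WithTop ℕ∞} [IsManifold I n M]

/-- The local section `σ_p : G\M → M` is `C^n` at every point of its source. -/
theorem contMDiffAt_localSection (hG : ActsBy G M (contDiffGroupoid n I)) (p : M)
    {q₀ : orbitRel.Quotient G M} (hq₀ : q₀ ∈ (localSection G p).source) :
    ContMDiffAt I I n (localSection G p) q₀ := by
  set x := localSection G p q₀ with hx_def
  set e := (localSection G p).trans (chartAt H x) with he_def
  have he : e ∈ IsManifold.maximalAtlas I n (orbitRel.Quotient G M) :=
    localSection_trans_mem_maximalAtlas hG p (chart_mem_atlas H x)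
  have hq : q₀ ∈ e.source := by
    rw [he_def, OpenPartialHomeomorph.trans_source]
    exact ⟨hq₀, mem_chart_source H x⟩
  have h1 : ContMDiffAt I I n e q₀ := contMDiffAt_of_mem_maximalAtlas he hq
  have h2 : ContMDiffAt I I n (chartAt H x).symm (e q₀) :=
    contMDiffAt_symm_of_mem_maximalAtlas (IsManifold.chart_mem_maximalAtlas x) (mem_chart_target H x)
  refine (h2.comp _ h1).congr_of_eventuallyEq ?_
  have h3 : ∀ᶠ q in 𝓝 q₀, localSection G p q ∈ (chartAt H x).source :=
    ((localSection G p).continuousAt hq₀).preimage_mem_nhds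
      ((chartAt H x).open_source.mem_nhds (mem_chart_source H x))
  filter_upwards [h3] with q hq3
  simp only [Function.comp_apply, he_def, OpenPartialHomeomorph.trans_apply,
    OpenPartialHomeomorph.left_inv _ hq3]

/-- The local sections `σ_p : G\M → M` are `C^n` on their sources. -/
theorem contMDiffOn_localSection (hG : ActsBy G M (contDiffGroupoid n I)) (p : M) :
    ContMDiffOn I I n (localSection G p) (localSection G p).source := fun _ hq =>
  (contMDiffAt_localSection hG p hq).contMDiffWithinAt

/-- **The quotient map `π : M → G\M` is `C^n`** (second item of Mathlib's TODO list in
`Geometry/Manifold/Instances/Quotient.lean`). -/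
theorem contMDiff_mk (hG : ActsBy G M (contDiffGroupoid n I)) :
    ContMDiff I I n (Quotient.mk (orbitRel G M) : M → orbitRel.Quotient G M) := by
  intro z₀
  set e := (localSection G z₀).trans (chartAt H z₀) with he_def
  have he : e ∈ IsManifold.maximalAtlas I n (orbitRel.Quotient G M) :=
    localSection_trans_mem_maximalAtlas hG z₀ (chart_mem_atlas H z₀)
  have h1 : ContMDiffAt I I n (chartAt H z₀) z₀ :=
    contMDiffAt_of_mem_maximalAtlas (IsManifold.chart_mem_maximalAtlas z₀) (mem_chart_source H z₀)
  have h2 : ContMDiffAt I I n e.symm (chartAt H z₀ z₀) := by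
    refine contMDiffAt_symm_of_mem_maximalAtlas he ?_
    rw [he_def, OpenPartialHomeomorph.trans_target]
    refine ⟨mem_chart_target H z₀, ?_⟩
    rw [mem_preimage, (chartAt H z₀).left_inv (mem_chart_source H z₀)]
    exact mem_localSection_target z₀
  refine (h2.comp _ h1).congr_of_eventuallyEq ?_
  filter_upwards [(chartAt H z₀).open_source.mem_nhds (mem_chart_source H z₀)] with z hz
  simp only [Function.comp_apply, he_def, OpenPartialHomeomorph.trans_symm_eq_symm_trans_symm,
    OpenPartialHomeomorph.trans_apply, (chartAt H z₀).left_inv hz, localSection_symm_apply]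

/-- The quotient map as a partial diffeomorphism near `p` (inverse: the local section `σ_p`). -/
def mkPartialDiffeomorph (hG : ActsBy G M (contDiffGroupoid n I)) (p : M) :
    PartialDiffeomorph I I M (orbitRel.Quotient G M) n where
  toPartialEquiv := (localSection G p).symm.toPartialEquiv
  open_source := (localSection G p).open_target
  open_target := (localSection G p).open_source
  contMDiffOn_toFun := by
    change ContMDiffOn I I n (localSection G p).symm (localSection G p).target
    rw [localSection_symm_eq]
    exact (contMDiff_mk hG).contMDiffOn
  contMDiffOn_invFun := by
    change ContMDiffOn I I n (localSection G p) (localSection G p).source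
    exact contMDiffOn_localSection hG p

/-- **The quotient map `π : M → G\M` is a `C^n` local diffeomorphism.** -/
theorem isLocalDiffeomorph_mk (hG : ActsBy G M (contDiffGroupoid n I)) :
    IsLocalDiffeomorph I I n (Quotient.mk (orbitRel G M) : M → orbitRel.Quotient G M) := fun p =>
  ⟨mkPartialDiffeomorph hG p, mem_localSection_target p, fun z _ => (localSection_symm_apply p z).symm⟩

/-! ### Maps `G₁\M → G\M` over `M` (two free properly discontinuous actions by `C^n` maps) -/

variable {G₁ : Type*} [Group G₁] [MulAction G₁ M] [ProperlyDiscontinuousSMul G₁ M] [ContinuousConstSMul G₁ M]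
  [IsCancelSMul G₁ M]

/-- **A map of quotients `f : G₁\M → G\M` over `M` (`f ∘ π₁ = π`; e.g. the map induced by `G₁ ≤ G`)
is `C^n`.** -/
theorem contMDiff_of_comp_mk_eq (hG₁ : ActsBy G₁ M (contDiffGroupoid n I))
    (hG : ActsBy G M (contDiffGroupoid n I)) (f : orbitRel.Quotient G₁ M → orbitRel.Quotient G M)
    (hf : ∀ z : M, f (Quotient.mk (orbitRel G₁ M) z) = Quotient.mk (orbitRel G M) z) :
    ContMDiff I I n f := by
  intro q₁
  obtain ⟨z₀, rfl⟩ := Quotient.mk_surjective (s := orbitRel G₁ M) q₁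
  have h1 : ContMDiffAt I I n (localSection G₁ z₀) (Quotient.mk (orbitRel G₁ M) z₀) :=
    contMDiffAt_localSection hG₁ z₀ (mem_localSection_source z₀)
  have h2 : ContMDiffAt I I n (Quotient.mk (orbitRel G M) : M → orbitRel.Quotient G M)
      (localSection G₁ z₀ (Quotient.mk (orbitRel G₁ M) z₀)) := contMDiff_mk hG _
  refine (h2.comp _ h1).congr_of_eventuallyEq ?_
  filter_upwards [(localSection G₁ z₀).open_source.mem_nhds (mem_localSection_source z₀)] with q hq
  rw [Function.comp_apply, ← hf, mk_localSection_apply z₀ hq]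

/-- The local model near `π₁ p` of a map of quotients over `M`: `σ¹_p ≫ π`. -/
def overPartialDiffeomorph (hG₁ : ActsBy G₁ M (contDiffGroupoid n I))
    (hG : ActsBy G M (contDiffGroupoid n I)) (p : M) :
    PartialDiffeomorph I I (orbitRel.Quotient G₁ M) (orbitRel.Quotient G M) n where
  toPartialEquiv := ((localSection G₁ p).trans (localSection G p).symm).toPartialEquiv
  open_source := ((localSection G₁ p).trans (localSection G p).symm).open_source
  open_target := ((localSection G₁ p).trans (localSection G p).symm).open_target
  contMDiffOn_toFun := by
    change ContMDiffOn I I n ((localSection G₁ p).trans (localSection G p).symm)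
      ((localSection G₁ p).trans (localSection G p).symm).source
    rw [OpenPartialHomeomorph.trans_source, OpenPartialHomeomorph.coe_trans, localSection_symm_eq]
    exact (contMDiff_mk hG).comp_contMDiffOn ((contMDiffOn_localSection hG₁ p).mono inter_subset_left)
  contMDiffOn_invFun := by
    change ContMDiffOn I I n ((localSection G₁ p).trans (localSection G p).symm).symm
      ((localSection G₁ p).trans (localSection G p).symm).target
    rw [← OpenPartialHomeomorph.symm_source, OpenPartialHomeomorph.trans_symm_eq_symm_trans_symm,
      OpenPartialHomeomorph.symm_symm, OpenPartialHomeomorph.trans_source, OpenPartialHomeomorph.coe_trans,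
      localSection_symm_eq]
    exact (contMDiff_mk hG₁).comp_contMDiffOn ((contMDiffOn_localSection hG p).mono inter_subset_left)

/-- **A map of quotients `f : G₁\M → G\M` over `M` is a `C^n` local diffeomorphism.** -/
theorem isLocalDiffeomorph_of_comp_mk_eq (hG₁ : ActsBy G₁ M (contDiffGroupoid n I))
    (hG : ActsBy G M (contDiffGroupoid n I)) (f : orbitRel.Quotient G₁ M → orbitRel.Quotient G M)
    (hf : ∀ z : M, f (Quotient.mk (orbitRel G₁ M) z) = Quotient.mk (orbitRel G M) z) :
    IsLocalDiffeomorph I I n f := by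
  intro q₁
  obtain ⟨p, rfl⟩ := Quotient.mk_surjective (s := orbitRel G₁ M) q₁
  refine ⟨overPartialDiffeomorph hG₁ hG p, ?_, ?_⟩
  · change Quotient.mk _ p ∈ ((localSection G₁ p).trans (localSection G p).symm).source
    rw [OpenPartialHomeomorph.trans_source]
    refine ⟨mem_localSection_source p, ?_⟩
    rw [mem_preimage, localSection_apply_mk, OpenPartialHomeomorph.symm_source]
    exact mem_localSection_target p
  · intro q hq
    change q ∈ ((localSection G₁ p).trans (localSection G p).symm).source at hq
    change f q = ((localSection G₁ p).trans (localSection G p).symm) q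
    rw [OpenPartialHomeomorph.trans_source] at hq
    rw [OpenPartialHomeomorph.trans_apply, localSection_symm_apply, ← hf, mk_localSection_apply p hq.1]

end Smooth

end HodgeCM.PerL34.QuotientManifold

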